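import Mathlib
import Summits.ABC.ABC.Theorems.RibetTakahashiSplitManyPrimeValuationProductJLPackagePrintedClass

/-!
# The Ribet–Takahashi–Pasten package on the semistable Frey class — stub `stub_jlPackageSF` of line
# `SketchIdeator1` (card waldspurger-localisation), crux stmt-ABC-15174
# `Summit.ABC.ABC.Theses.RibetTakahashiSplit.ManyPrimeValuationProductSemistableFrey`

Registered signature = the skeleton's `JLPackageSF`
(`Cruxes/ManyPrimeValuationProductSemistableFrey/Lines/SketchIdeator1.lean`) with the abbreviations
`IsSemistable`, `IsFreyIsomorphic`, `FermatInput`, `IsCoveringSet`, `multPrimes`, `discOf`, `valProd`,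
`pet`, `IsNeronPeriodPairOf` unfolded: for every `ε > 0` there is `C` such that for every `W/ℚ` elliptic,
semistable, `ℚ`-isomorphic to a twisted Frey–Hellegouarch curve, with the Fermat input at every prime
`ℓ ≥ 11`, and every covering set `D` of multiplicative primes, there are a Néron period pair `L`, a
Shimura-curve datum `S` of level `(∏D, N/∏D)`, a fundamental domain `F` of finite positive area and a
non-zero weight-`2` form `s` on `S.Gamma` with periods in `Λ_L`, `‖s‖²_pt` and `log ‖s‖²_pt` integrable
on `F`, `‖s‖²_pt > 0` a.e., `∫_F ‖s‖²_pt > 0`, and the PACKAGE INEQUALITY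
`log T_D ≤ C + ε log N + log vol(F) − log ∫_F ‖s‖²_pt`.

KNOWN in print: H. Pasten, *Shimura curves and the abc conjecture* (arXiv:1705.09251), Thm 6.1 (b.1)
(semistable, `M` not prime) + §16 (proof of Thm 16.4). Unconditionally it is a Shimura-curve programme
(existence of `X₀^D(M)` data and Jacquet–Langlands parametrisations, Shimizu's volume, Thm 6.1 (b), …).
In the tree it is EXACTLY the parent crux's (stmt-ABC-1561) package on the printed class,
`Summit.ABC.ABC.Theorems.ManyPrimeValuationProduct.JLPackage.jlPackage_printedClass_of_facts`
(Theorems/…JLPackagePrintedClass.lean), which has the same conclusion and the hypotheses "semistable away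
from `2`", Fermat input, and `semistable ∨ IsFreyHellegouarch`, conditional on eleven NAMED facts.

Result: `jlPackageSF_of_facts` — the registered signature conditional on exactly those eleven named facts
(same order), obtained from `jlPackage_printedClass_of_facts` with the disjunct `Or.inl` (semistable) and
"semistable away from `2`" read off from semistability; the Frey-isomorphism hypothesis of this crux's
class is not used. Hence `stub_jlPackageSF` is `jlPackageSF_of_facts h₁ … h₁₁` by `rfl`-unfolding (the
form registered with `ledger workitem stub-add stmt-ABC-15174 --name jlPackageSF_of_facts`); the
unconditional stub stays open on `Literature.NumberTheory.Automorphic.PastenShimura2024_thm_6_1_b` and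
its ten companions.
-/

-- `Summit.ABC.ABC` is the mandated summit-side namespace (CONVENTIONS §2); the duplicate is deliberate.
set_option linter.dupNamespace false

noncomputable section

open MeasureTheory
open scoped MatrixGroups

namespace Summit.ABC.ABC.Theorems.ManyPrimeValuationProductSemistableFrey

/-- **Registered sub-goal of `stub_jlPackageSF`: `JLPackageSF` closed modulo named facts.** The
skeleton's `JLPackageSF` (abbreviations `IsSemistable`, `IsFreyIsomorphic`, `FermatInput`,
`IsCoveringSet`, `multPrimes`, `discOf`, `valProd`, `pet`, `IsNeronPeriodPairOf` unfolded), conditional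
on exactly the eleven NAMED facts of
`Summit.ABC.ABC.Theorems.ManyPrimeValuationProduct.JLPackage.jlPackage_printedClass_of_facts`, in the
same order: nine of `Literature.NumberTheory.Automorphic.ShimuraCurveRibetTakahashi` (existence of
`X₀^D(M)` data `nonempty_shimuraCurveData`, Shimizu's volume `ShimuraCurveData.volume_fd_eq`, existence of
Jacquet–Langlands parametrisations `nonempty_shimuraParametrizationData`, Frey's identity
`ShimuraParametrizationData.normSq_form_eq_deg_mul_covolume`, the Mazur–Kenku comparison
`ShimuraParametrizationData.minimalDegree_le_163_mul`, H. Pasten, *Shimura curves and the abc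
conjecture*, arXiv:1705.09251, Thm 6.1 (b) `PastenShimura2024_thm_6_1_b`, the optimal quotient
`exists_optimal_modularParametrizationData`, Pasten Cor 10.2 `PastenShimura2024_cor_10_2`, the
Petersson bound `murty_petersson_newform_upper_bound`), the height comparison
`Literature.NumberTheory.EllipticCurves.ModularForms.abs_neronLatticeHeight_sub_le_of_isIsogenous`
(Faltings + Mazur–Kenku) and the analytic folklore fact
`Literature.NumberTheory.Automorphic.shimuraCurve_pet_pos_ae_and_log_integrable`. Proof: Pasten §16
(proof of Thm 16.4) in case (b.1) — apply `jlPackage_printedClass_of_facts` with the class disjunct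
`Or.inl` (semistable); its hypothesis "semistable away from `2`" is the restriction of semistability,
and the Frey isomorphism is not used. `[cite: PastenShimura2024, Thm 6.1 (b.1) and §16]` `[folklore]` -/
theorem jlPackageSF_of_facts :
    Literature.NumberTheory.Automorphic.nonempty_shimuraCurveData →
    Literature.NumberTheory.Automorphic.ShimuraCurveData.volume_fd_eq →
    Literature.NumberTheory.Automorphic.nonempty_shimuraParametrizationData →
    Literature.NumberTheory.Automorphic.ShimuraParametrizationData.normSq_form_eq_deg_mul_covolume →
    Literature.NumberTheory.Automorphic.ShimuraParametrizationData.minimalDegree_le_163_mul →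
    Literature.NumberTheory.Automorphic.PastenShimura2024_thm_6_1_b →
    Literature.NumberTheory.Automorphic.exists_optimal_modularParametrizationData →
    Literature.NumberTheory.Automorphic.PastenShimura2024_cor_10_2 →
    Literature.NumberTheory.Automorphic.murty_petersson_newform_upper_bound →
    Literature.NumberTheory.EllipticCurves.ModularForms.abs_neronLatticeHeight_sub_le_of_isIsogenous →
    Literature.NumberTheory.Automorphic.shimuraCurve_pet_pos_ae_and_log_integrable →
    ∀ ε : ℝ, 0 < ε → ∃ C : ℝ, ∀ (W : WeierstrassCurve ℚ) [W.IsElliptic],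
      (∀ p : ℕ, p.Prime → ¬ p ^ 2 ∣ W.conductorNorm ℤ) →
      (∃ (a b d : ℤ) (C' : WeierstrassCurve.VariableChange ℚ), IsCoprime a b ∧ a * b * (a + b) ≠ 0 ∧
        d ∣ 2 ∧ C' • W = Literature.NumberTheory.EllipticCurves.freyCurve (d * a) (d * b)) →
      (∀ ℓ : ℕ, ℓ.Prime → 11 ≤ ℓ →
        ∃ r ∈ (W.conductorNorm ℤ).primeFactors.filter (fun p => ¬ p ^ 2 ∣ W.conductorNorm ℤ),
          ¬ ℓ ∣ (W.minimalDiscriminantNorm ℤ).factorization r) →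
      ∀ D : Finset ℕ,
        (D ⊆ (W.conductorNorm ℤ).primeFactors.filter (fun p => ¬ p ^ 2 ∣ W.conductorNorm ℤ) ∧
          Even D.card ∧ 2 ≤ D.card ∧
          2 ≤ ((W.conductorNorm ℤ).primeFactors.filter (fun p => ¬ p ^ 2 ∣ W.conductorNorm ℤ) \ D).card) →
        ∃ (L : PeriodPair)
          (S : Literature.NumberTheory.Automorphic.ShimuraCurveData (∏ p ∈ D, p)
            (W.conductorNorm ℤ / ∏ p ∈ D, p))
          (F : Set UpperHalfPlane) (s : CuspForm S.Gamma 2),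
          (∃ C : WeierstrassCurve.VariableChange ℚ, (C • W).IsGloballyMinimal ∧
            Literature.NumberTheory.EllipticCurves.ModularForms.IsNeronLatticeOf
              ((C • W).baseChange ℂ) L) ∧
          Literature.NumberTheory.Automorphic.IsHypFundamentalDomain S.Gamma F ∧
          MeasureTheory.volume F ≠ 0 ∧ MeasureTheory.volume F ≠ ⊤ ∧ s ≠ 0 ∧
          Literature.NumberTheory.Automorphic.HasPeriodsIn S.Gamma s (L.lattice : Set ℂ) ∧
          MeasureTheory.IntegrableOn (fun z : UpperHalfPlane => ‖s z‖ ^ 2 * z.im ^ 2) F ∧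
          MeasureTheory.IntegrableOn (fun z : UpperHalfPlane => Real.log (‖s z‖ ^ 2 * z.im ^ 2)) F ∧
          (∀ᵐ z ∂(MeasureTheory.volume.restrict F), 0 < ‖s z‖ ^ 2 * z.im ^ 2) ∧
          (0 < ∫ z in F, ‖s z‖ ^ 2 * z.im ^ 2) ∧
          Real.log ((∏ p ∈ D, (W.minimalDiscriminantNorm ℤ).factorization p : ℕ) : ℝ) ≤
            C + ε * Real.log (W.conductorNorm ℤ) + Real.log (MeasureTheory.volume F).toReal -
              Real.log (∫ z in F, ‖s z‖ ^ 2 * z.im ^ 2) := by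
  intro h₁ h₂ h₃ h₄ h₅ h₆ h₇ h₈ h₉ h₁₀ h₁₁ ε hε
  obtain ⟨C, hC⟩ :=
    Summit.ABC.ABC.Theorems.ManyPrimeValuationProduct.JLPackage.jlPackage_printedClass_of_facts
      h₁ h₂ h₃ h₄ h₅ h₆ h₇ h₈ h₉ h₁₀ h₁₁ ε hε
  exact ⟨C, fun W _ hss _hfr hF D hD => hC W (fun p hp _ => hss p hp) hF (Or.inl hss) D hD⟩

end Summit.ABC.ABC.Theorems.ManyPrimeValuationProductSemistableFrey

end
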